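import Summits.CriticalPhenomena.PercolationContinuityZ3.Theorems.Transplant.GrigorchukPowerLaceOperatorsForms
import Summits.CriticalPhenomena.PercolationContinuityZ3.Theorems.Transplant.GrigorchukPowerNcHaraSladeLaceNormLemmas
import HarnessLib

/-!
# W4 S3b-α «LaceOperators» (third file): the ℓ²-weights `ω_η(x)`, `κ(η)`, the identity `⟪η, ρ(K)η⟫ = (ΣK)‖η‖² − Σ_x K(x) ω_η(x)`, and the EXTENSION LEMMA
# «Σ_x |K(x)| ω_ξ(x) ≤ B κ₀(ξ) on finitely supported ξ ⇒ Σ_x |K(x)| ω_η(x) ≤ B κ(η) on all of ℓ²» (critic P-37-c)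

Definition + proof file (`--kind definition`, `--supports stmt-CriticalPhenomena-4575 --as helper`), lane `prim-bschramm`, seat `prim-bschramm-gen-1` gen 13 (GEN pen);
item α of the director's S3b WORD (#10178) / lead :588, design text P3-NILPOTENT §38 — this is α₃ = (d7) `omegaL2`/`kappaL2` with `omegaL2_toL2 = omegaV`,
`kappaL2_toL2 = kappa0`, `0 ≤ ω ≤ 2‖η‖²`, `kappaL2 = (4k)⁻¹ Σ_s ω_η(s)`, the Lipschitz bounds in `η`; (L3) `inner_kernelOp_eq` («Ψ = a − Ω» of (37.2)(iii) in operator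
form); (L4) **`tsum_abs_mul_omegaL2_le`** — the `⨆`-clause of DEFS-C's `laceNormE` becomes the OPERATOR inequality `±Ω ≼ B(1 − P)` on `ℓ²`: the finitely
supported case is the hypothesis (with `κ₀(ξ) = 0 ⇒ ω_ξ ≡ 0` by invariance under the generated group — critic P-39-a), the general case by truncation
`η ↦ η·𝟙_F` and the Lipschitz bounds (no dominated-convergence machinery); §5 `inner_twoPointOp_nonneg`: `T ≽ 0` on all of `ℓ²` (same truncation, from E4.3b
`conn_quadratic_nonneg` via α₂ (L1); design note p3 g43 #10305).  Serves S3b′ via P3-NILPOTENT §37.2; ASSERTS NOTHING about it.  builds on p205010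
(kernel theorem, internal audit signed; external expert review pending) — nothing here uses p205010.  No instance, no notation, no sorry; `k ≥ 1` where `4k` is
inverted.
[cite: HeydenreichVanDerHofstad2017, §8.3 (the weight 1 − D̂(k); Prop. 8.3), Lemma 8.11–8.12]
-/

noncomputable section

namespace Summit.CriticalPhenomena.PercolationContinuityZ3.Theorems.Transplant

namespace Grigorchuk

namespace NcHaraSlade

open SimpleGraph Literature.Probability.Percolation Literature.Barriers.CriticalPhenomena
open scoped ENNReal Classical InnerProductSpace

variable {k : ℕ}

/-! ## §1 (d7) The weights on `ℓ²` -/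

/-- **(d7) `omegaL2 η x = ‖η‖² − ⟪η, ρ(x)η⟫`** — DEFS-C's `omegaV` on all of `ℓ²`. [cite: HeydenreichVanDerHofstad2017, §8.3] -/
def omegaL2 (η : lp (fun _ : GPow k => ℝ) 2) (x : GPow k) : ℝ := ‖η‖ ^ 2 - ⟪η, rhoL x η⟫_ℝ

/-- **(d7) `kappaL2 k η = ⟪η, (1 − P) η⟫`** — DEFS-C's `kappa0` on all of `ℓ²`. [cite: HeydenreichVanDerHofstad2017, §8.3] -/
def kappaL2 (k : ℕ) (η : lp (fun _ : GPow k => ℝ) 2) : ℝ := ⟪η, (1 - srwOp k) η⟫_ℝ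

/-- `|⟪η, ρ(x)η⟫| ≤ ‖η‖²`. [folklore] -/
theorem abs_inner_rhoL_le (η : lp (fun _ : GPow k => ℝ) 2) (x : GPow k) : |⟪η, rhoL x η⟫_ℝ| ≤ ‖η‖ ^ 2 := by
  calc |⟪η, rhoL x η⟫_ℝ| ≤ ‖η‖ * ‖rhoL x η‖ := abs_real_inner_le_norm _ _
    _ = ‖η‖ ^ 2 := by rw [norm_rhoL_apply, sq]

/-- **`0 ≤ ω_η(x)`**. [cite: HeydenreichVanDerHofstad2017, §8.3] -/
theorem omegaL2_nonneg (η : lp (fun _ : GPow k => ℝ) 2) (x : GPow k) : 0 ≤ omegaL2 η x := by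
  have h := abs_inner_rhoL_le η x
  have h' := le_abs_self ⟪η, rhoL x η⟫_ℝ
  unfold omegaL2; linarith

/-- **`ω_η(x) ≤ 2‖η‖²`**. [cite: HeydenreichVanDerHofstad2017, §8.3] -/
theorem omegaL2_le (η : lp (fun _ : GPow k => ℝ) 2) (x : GPow k) : omegaL2 η x ≤ 2 * ‖η‖ ^ 2 := by
  have h := abs_inner_rhoL_le η x
  have h' := neg_abs_le ⟪η, rhoL x η⟫_ℝ
  unfold omegaL2; linarith

/-- `‖toL2 ξ‖² = Σ_{y ∈ supp} ξ(y)²`. [folklore] -/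
theorem norm_toL2_sq (ξ : GPow k →₀ ℝ) : ‖toL2 ξ‖ ^ 2 = ∑ y ∈ ξ.support, ξ y * ξ y := by
  rw [← real_inner_self_eq_norm_sq, lp.inner_eq_tsum,
    tsum_eq_sum (s := ξ.support) (fun y hy => by rw [toL2_apply, Finsupp.notMem_support_iff.1 hy]; simp)]
  exact Finset.sum_congr rfl fun y _ => by rw [Real.inner_apply, toL2_apply]

/-- `⟪toL2 ξ, ρ(x) toL2 ξ⟫ = Σ_{y ∈ supp} ξ(y) ξ(y x)`. [folklore] -/
theorem inner_toL2_rhoL (ξ : GPow k →₀ ℝ) (x : GPow k) : ⟪toL2 ξ, rhoL x (toL2 ξ)⟫_ℝ = ∑ y ∈ ξ.support, ξ y * ξ (y * x) := by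
  rw [lp.inner_eq_tsum, tsum_eq_sum (s := ξ.support) (fun y hy => by rw [Real.inner_apply, toL2_apply, Finsupp.notMem_support_iff.1 hy, zero_mul])]
  exact Finset.sum_congr rfl fun y _ => by rw [Real.inner_apply, rhoL_apply, toL2_apply, toL2_apply]

/-- **`omegaL2 (toL2 ξ) x = omegaV ξ x`** (the dictionary for the weight). [cite: HeydenreichVanDerHofstad2017, §8.3] -/
theorem omegaL2_toL2 (ξ : GPow k →₀ ℝ) (x : GPow k) : omegaL2 (toL2 ξ) x = omegaV ξ x := by
  rw [omegaL2, norm_toL2_sq, inner_toL2_rhoL, omegaV]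

/-- **`kappaL2 k η = (4k)⁻¹ Σ_{s ∈ S_k} ω_η(s)`** for `k ≥ 1`. [cite: HeydenreichVanDerHofstad2017, §8.3 (1 − D̂(k) = |S|⁻¹ Σ_s (1 − cos k·s))] -/
theorem kappaL2_eq_sum (hk : 1 ≤ k) (η : lp (fun _ : GPow k => ℝ) 2) : kappaL2 k η = (1 / (4 * (k : ℝ))) * ∑ s ∈ gkGens k, omegaL2 η s := by
  have h1 : (1 : ℝ) ≤ k := by exact_mod_cast hk
  have hk' : (4 * (k : ℝ)) ≠ 0 := by positivity
  have hP : ⟪η, srwOp k η⟫_ℝ = (1 / (4 * (k : ℝ))) * ∑ s ∈ gkGens k, ⟪η, rhoL s η⟫_ℝ := by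
    simp only [srwOp, adjOp, FunLike.coe_smul, Pi.smul_apply, FunLike.coe_sum, Finset.sum_apply, real_inner_smul_right, inner_sum]
  unfold kappaL2 omegaL2
  rw [sub_apply, one_apply_eq_self, inner_sub_right, real_inner_self_eq_norm_sq, hP, Finset.sum_sub_distrib,
    Finset.sum_const, card_gkGens, nsmul_eq_mul]
  push_cast
  field_simp

/-- **`kappaL2 k (toL2 ξ) = kappa0 k ξ`** for `k ≥ 1` (the dictionary for the Laplacian form). [cite: HeydenreichVanDerHofstad2017, §8.3] -/
theorem kappaL2_toL2 (hk : 1 ≤ k) (ξ : GPow k →₀ ℝ) : kappaL2 k (toL2 ξ) = kappa0 k ξ := by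
  rw [kappaL2_eq_sum hk, kappa0]
  simp_rw [omegaL2_toL2]
  rw [one_div, inv_mul_eq_div]

/-- `0 ≤ κ(η)` (`k ≥ 1`). [folklore] -/
theorem kappaL2_nonneg (hk : 1 ≤ k) (η : lp (fun _ : GPow k => ℝ) 2) : 0 ≤ kappaL2 k η := by
  rw [kappaL2_eq_sum hk]
  exact mul_nonneg (by positivity) (Finset.sum_nonneg fun s _ => omegaL2_nonneg η s)

/-! ## §2 Lipschitz bounds in `η` (the approximation tool for (L4)) -/

/-- `|ω_η(x) − ω_ζ(x)| ≤ 2 (‖η‖ + ‖ζ‖) ‖η − ζ‖`. [folklore] -/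
theorem abs_omegaL2_sub_le (η ζ : lp (fun _ : GPow k => ℝ) 2) (x : GPow k) :
    |omegaL2 η x - omegaL2 ζ x| ≤ 2 * (‖η‖ + ‖ζ‖) * ‖η - ζ‖ := by
  have h1 : |‖η‖ ^ 2 - ‖ζ‖ ^ 2| ≤ (‖η‖ + ‖ζ‖) * ‖η - ζ‖ := by
    rw [sq_sub_sq, abs_mul, abs_of_nonneg (by positivity)]
    exact mul_le_mul_of_nonneg_left (abs_norm_sub_norm_le η ζ) (by positivity)
  have h2 : ⟪η, rhoL x η⟫_ℝ - ⟪ζ, rhoL x ζ⟫_ℝ = ⟪η - ζ, rhoL x η⟫_ℝ + ⟪ζ, rhoL x (η - ζ)⟫_ℝ := by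
    rw [inner_sub_left, map_sub, inner_sub_right]; ring
  have h3 : |⟪η, rhoL x η⟫_ℝ - ⟪ζ, rhoL x ζ⟫_ℝ| ≤ (‖η‖ + ‖ζ‖) * ‖η - ζ‖ := by
    rw [h2]
    calc |⟪η - ζ, rhoL x η⟫_ℝ + ⟪ζ, rhoL x (η - ζ)⟫_ℝ| ≤ |⟪η - ζ, rhoL x η⟫_ℝ| + |⟪ζ, rhoL x (η - ζ)⟫_ℝ| := abs_add_le _ _
      _ ≤ ‖η - ζ‖ * ‖rhoL x η‖ + ‖ζ‖ * ‖rhoL x (η - ζ)‖ := add_le_add (abs_real_inner_le_norm _ _) (abs_real_inner_le_norm _ _)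
      _ = (‖η‖ + ‖ζ‖) * ‖η - ζ‖ := by rw [norm_rhoL_apply, norm_rhoL_apply]; ring
  unfold omegaL2
  calc |‖η‖ ^ 2 - ⟪η, rhoL x η⟫_ℝ - (‖ζ‖ ^ 2 - ⟪ζ, rhoL x ζ⟫_ℝ)| = |(‖η‖ ^ 2 - ‖ζ‖ ^ 2) - (⟪η, rhoL x η⟫_ℝ - ⟪ζ, rhoL x ζ⟫_ℝ)| := by ring_nf
    _ ≤ |‖η‖ ^ 2 - ‖ζ‖ ^ 2| + |⟪η, rhoL x η⟫_ℝ - ⟪ζ, rhoL x ζ⟫_ℝ| := abs_sub _ _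
    _ ≤ 2 * (‖η‖ + ‖ζ‖) * ‖η - ζ‖ := by linarith

/-- `ω_η(x) |K x|` is summable in `x` for `K ∈ ℓ¹`. [folklore] -/
theorem summable_abs_mul_omegaL2 (η : lp (fun _ : GPow k => ℝ) 2) {K : GPow k → ℝ} (hK : Summable fun x => |K x|) :
    Summable fun x => |K x| * omegaL2 η x :=
  (hK.mul_right (2 * ‖η‖ ^ 2)).of_nonneg_of_le (fun x => mul_nonneg (abs_nonneg _) (omegaL2_nonneg η x))
    fun x => mul_le_mul_of_nonneg_left (omegaL2_le η x) (abs_nonneg _)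

/-- `|Σ_x |K x| ω_η(x) − Σ_x |K x| ω_ζ(x)| ≤ ‖K‖₁ · 2(‖η‖ + ‖ζ‖)‖η − ζ‖`. [folklore] -/
theorem abs_tsum_abs_mul_omegaL2_sub_le (η ζ : lp (fun _ : GPow k => ℝ) 2) {K : GPow k → ℝ} (hK : Summable fun x => |K x|) :
    |∑' x, |K x| * omegaL2 η x - ∑' x, |K x| * omegaL2 ζ x| ≤ (∑' x, |K x|) * (2 * (‖η‖ + ‖ζ‖) * ‖η - ζ‖) := by
  have h1 := summable_abs_mul_omegaL2 η hK
  have h2 := summable_abs_mul_omegaL2 ζ hK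
  have hd : Summable fun x => |K x| * omegaL2 η x - |K x| * omegaL2 ζ x := h1.sub h2
  have hs : Summable fun x => |K x| * (2 * (‖η‖ + ‖ζ‖) * ‖η - ζ‖) := hK.mul_right _
  rw [← h1.tsum_sub h2, ← tsum_mul_right]
  calc |∑' x, (|K x| * omegaL2 η x - |K x| * omegaL2 ζ x)| ≤ ∑' x, |(|K x| * omegaL2 η x - |K x| * omegaL2 ζ x)| := by
        have hn : Summable fun x => ‖|K x| * omegaL2 η x - |K x| * omegaL2 ζ x‖ := by simpa only [Real.norm_eq_abs] using hd.abs
        have h := norm_tsum_le_tsum_norm hn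
        simpa only [Real.norm_eq_abs] using h
    _ ≤ ∑' x, |K x| * (2 * (‖η‖ + ‖ζ‖) * ‖η - ζ‖) := by
        refine hd.abs.tsum_le_tsum (fun x => ?_) hs
        rw [← mul_sub, abs_mul, abs_abs]
        exact mul_le_mul_of_nonneg_left (abs_omegaL2_sub_le η ζ x) (abs_nonneg _)

/-- `|κ(η) − κ(ζ)| ≤ 2 (‖η‖ + ‖ζ‖) ‖η − ζ‖` (`k ≥ 1`). [folklore] -/
theorem abs_kappaL2_sub_le (hk : 1 ≤ k) (η ζ : lp (fun _ : GPow k => ℝ) 2) : |kappaL2 k η - kappaL2 k ζ| ≤ 2 * (‖η‖ + ‖ζ‖) * ‖η - ζ‖ := by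
  have h1 : (1 : ℝ) ≤ k := by exact_mod_cast hk
  have hk' : (0 : ℝ) < 4 * k := by linarith
  rw [kappaL2_eq_sum hk, kappaL2_eq_sum hk, ← mul_sub, ← Finset.sum_sub_distrib, abs_mul, abs_of_pos (by positivity)]
  calc 1 / (4 * (k : ℝ)) * |∑ s ∈ gkGens k, (omegaL2 η s - omegaL2 ζ s)|
      ≤ 1 / (4 * (k : ℝ)) * ∑ s ∈ gkGens k, |omegaL2 η s - omegaL2 ζ s| := mul_le_mul_of_nonneg_left (Finset.abs_sum_le_sum_abs _ _) (by positivity)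
    _ ≤ 1 / (4 * (k : ℝ)) * ∑ _s ∈ gkGens k, 2 * (‖η‖ + ‖ζ‖) * ‖η - ζ‖ :=
        mul_le_mul_of_nonneg_left (Finset.sum_le_sum fun s _ => abs_omegaL2_sub_le η ζ s) (by positivity)
    _ = 2 * (‖η‖ + ‖ζ‖) * ‖η - ζ‖ := by rw [Finset.sum_const, card_gkGens, nsmul_eq_mul]; push_cast; field_simp

/-! ## §3 (L3) `⟪η, ρ(K)η⟫ = (Σ K) ‖η‖² − Σ_x K(x) ω_η(x)` -/

/-- `x ↦ K(x) ω_η(x)` is summable for `K ∈ ℓ¹`. [folklore] -/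
theorem summable_mul_omegaL2 (η : lp (fun _ : GPow k => ℝ) 2) {K : GPow k → ℝ} (hK : Summable fun x => |K x|) :
    Summable fun x => K x * omegaL2 η x :=
  Summable.of_norm_bounded (summable_abs_mul_omegaL2 η hK) fun x => by
    rw [Real.norm_eq_abs, abs_mul, abs_of_nonneg (omegaL2_nonneg η x)]

/-- **(L3) `⟪η, ρ(K) η⟫ = (Σ_x K x) ‖η‖² − Σ_x K(x) ω_η(x)`** for `K ∈ ℓ¹`, `η ∈ ℓ²` — (37.2)(iii)'s «Ψ = a − Ω» at `Ψ = 1 + ρ(K)`, in operator form.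
[cite: HeydenreichVanDerHofstad2017, §8.3, Lemma 8.11] -/
theorem inner_kernelOp_eq {K : GPow k → ℝ} (hK : Summable fun x => |K x|) (η : lp (fun _ : GPow k => ℝ) 2) :
    ⟪η, kernelOp K η⟫_ℝ = (∑' x, K x) * ‖η‖ ^ 2 - ∑' x, K x * omegaL2 η x := by
  rw [kernelOp_apply hK, ← innerSL_apply_apply (𝕜 := ℝ), (innerSL ℝ η).map_tsum (summable_smul_rhoL_apply hK η)]
  simp only [innerSL_apply_apply, real_inner_smul_right]
  have h : ∀ x, K x * ⟪η, rhoL x η⟫_ℝ = K x * ‖η‖ ^ 2 - K x * omegaL2 η x := fun x => by unfold omegaL2; ring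
  simp_rw [h]
  rw [(hK.of_abs.mul_right _).tsum_sub (summable_mul_omegaL2 η hK), tsum_mul_right]

/-! ## §4 (L4) The extension lemma (critic P-37-c) -/

/-- `0 ≤ κ₀(ξ)`. [folklore] -/
theorem kappa0_nonneg (ξ : GPow k →₀ ℝ) : 0 ≤ kappa0 k ξ :=
  div_nonneg (Finset.sum_nonneg fun s _ => omegaV_nonneg ξ s) (by positivity)

/-- **`κ₀(ξ) = 0 ⇒ ω_ξ ≡ 0`** (`k ≥ 1`): `ω_ξ(s) = ½ Σ_y (ξ(y) − ξ(ys))² = 0` for every generator forces `ξ(y s) = ξ(y)`, hence `ξ(y g) = ξ(y)` for every `g` in the group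
the `S_k` generate (all of `𝔊^k`), hence `ω_ξ(x) = 0` (critic P-39-a: invariance, not infinitude). [cite: HeydenreichVanDerHofstad2017, §8.3] -/
theorem omegaV_eq_zero_of_kappa0_eq_zero (hk : 1 ≤ k) (ξ : GPow k →₀ ℝ) (h0 : kappa0 k ξ = 0) (x : GPow k) : omegaV ξ x = 0 := by
  have h1 : (1 : ℝ) ≤ k := by exact_mod_cast hk
  have hk' : (4 * (k : ℝ)) ≠ 0 := by positivity
  have hsum : ∑ s ∈ gkGens k, omegaV ξ s = 0 := by
    rw [kappa0, div_eq_zero_iff] at h0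
    exact h0.resolve_right hk'
  have hgen : ∀ s ∈ gkGens k, ∀ y, ξ (y * s) = ξ y := by
    intro s hs y
    have hω : omegaV ξ s = 0 := (Finset.sum_eq_zero_iff_of_nonneg fun s _ => omegaV_nonneg ξ s).1 hsum s hs
    have ht : ∑' y, (ξ y - ξ (y * s)) ^ 2 = 0 := by rw [tsum_sq_sub_shift_eq, hω, mul_zero]
    have hs' : Summable fun y => (ξ y - ξ (y * s)) ^ 2 := by simpa using summable_sq_sub ξ 1 s
    have hall := (hasSum_zero_iff_of_nonneg fun y => sq_nonneg (ξ y - ξ (y * s))).1 (ht ▸ hs'.hasSum)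
    have hy := congr_fun hall y
    simp only [Pi.zero_apply, sq_eq_zero_iff, sub_eq_zero] at hy
    exact hy.symm
  have hall : ∀ g : GPow k, ∀ y, ξ (y * g) = ξ y := by
    intro g
    have hg : g ∈ Subgroup.closure (↑(gkGens k) : Set (GPow k)) := by rw [closure_gkGens]; exact Subgroup.mem_top g
    refine Subgroup.closure_induction (p := fun g _ => ∀ y, ξ (y * g) = ξ y) ?_ ?_ ?_ ?_ hg
    · exact fun s hs y => hgen s (Finset.mem_coe.1 hs) y
    · intro y; rw [mul_one]
    · intro a b _ _ ha hb y; rw [← mul_assoc, hb, ha]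
    · intro a _ ha y
      have := ha (y * a⁻¹)
      rw [inv_mul_cancel_right] at this
      exact this.symm
  unfold omegaV
  rw [sub_eq_zero]
  exact Finset.sum_congr rfl fun y _ => by rw [hall x y]

/-- The finitely supported case of (L4), including `κ₀ = 0` (both sides vanish). [cite: HeydenreichVanDerHofstad2017, Prop. 8.3] -/
theorem tsum_abs_mul_omegaV_le (hk : 1 ≤ k) {K : GPow k → ℝ} {B : ℝ}
    (hB : ∀ ξ : GPow k →₀ ℝ, 0 < kappa0 k ξ → ∑' x, |K x| * omegaV ξ x ≤ B * kappa0 k ξ) (ξ : GPow k →₀ ℝ) :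
    ∑' x, |K x| * omegaV ξ x ≤ B * kappa0 k ξ := by
  by_cases h : 0 < kappa0 k ξ
  · exact hB ξ h
  · have h0 : kappa0 k ξ = 0 := le_antisymm (not_lt.1 h) (kappa0_nonneg ξ)
    have hω : ∀ x, omegaV ξ x = 0 := omegaV_eq_zero_of_kappa0_eq_zero hk ξ h0
    simp [hω, h0]

/-- Truncation of `η ∈ ℓ²` to a finite set, as a finitely supported vector. [folklore] -/
def truncL2 (η : lp (fun _ : GPow k => ℝ) 2) (F : Finset (GPow k)) : GPow k →₀ ℝ :=
  Finsupp.onFinset F (fun y => if y ∈ F then η y else 0) fun y hy => by by_contra h; exact hy (if_neg h)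

/-- `truncL2 η F y = if y ∈ F then η y else 0`. [folklore] -/
theorem truncL2_apply (η : lp (fun _ : GPow k => ℝ) 2) (F : Finset (GPow k)) (y : GPow k) : truncL2 η F y = if y ∈ F then η y else 0 :=
  Finsupp.onFinset_apply

/-- `Σ_y η(y)² = ‖η‖²` (the `ℓ²` norm as an unconditional sum). [folklore] -/
theorem hasSum_sq_norm (η : lp (fun _ : GPow k => ℝ) 2) : HasSum (fun y => η y ^ 2) (‖η‖ ^ 2) := by
  have h := lp.hasSum_norm (by norm_num) η
  simp only [ENNReal.toReal_ofNat, Real.rpow_two, Real.norm_eq_abs, sq_abs] at h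
  exact h

/-- `‖η − toL2 (truncL2 η F)‖² + Σ_{y∈F} η(y)² = ‖η‖²`. [folklore] -/
theorem norm_sub_truncL2_sq (η : lp (fun _ : GPow k => ℝ) 2) (F : Finset (GPow k)) :
    ‖η - toL2 (truncL2 η F)‖ ^ 2 + ∑ y ∈ F, η y ^ 2 = ‖η‖ ^ 2 := by
  have hrest := hasSum_sq_norm (η - toL2 (truncL2 η F))
  have hF : HasSum (fun y => if y ∈ F then η y ^ 2 else 0) (∑ y ∈ F, η y ^ 2) := by
    have h : HasSum (fun y => if y ∈ F then η y ^ 2 else 0) (∑ y ∈ F, (if y ∈ F then η y ^ 2 else 0)) :=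
      hasSum_sum_of_ne_finset_zero fun y hy => if_neg hy
    rwa [Finset.sum_congr rfl (fun y hy => if_pos hy)] at h
  have hsum := hrest.add hF
  have heq : (fun y => (η - toL2 (truncL2 η F)) y ^ 2 + (if y ∈ F then η y ^ 2 else 0)) = fun y => η y ^ 2 := by
    funext y
    rw [lp.coeFn_sub, Pi.sub_apply, toL2_apply, truncL2_apply]
    split_ifs <;> ring
  rw [heq] at hsum
  exact hsum.unique (hasSum_sq_norm η)

/-- `‖toL2 (truncL2 η F)‖ ≤ ‖η‖`. [folklore] -/
theorem norm_toL2_truncL2_le (η : lp (fun _ : GPow k => ℝ) 2) (F : Finset (GPow k)) : ‖toL2 (truncL2 η F)‖ ≤ ‖η‖ := by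
  have h1 : ‖toL2 (truncL2 η F)‖ ^ 2 ≤ ∑ y ∈ F, η y ^ 2 := by
    rw [norm_toL2_sq]
    calc ∑ y ∈ (truncL2 η F).support, truncL2 η F y * truncL2 η F y ≤ ∑ y ∈ F, truncL2 η F y * truncL2 η F y :=
          Finset.sum_le_sum_of_subset_of_nonneg (Finsupp.support_onFinset_subset) fun y _ _ => mul_self_nonneg _
      _ = ∑ y ∈ F, η y ^ 2 := Finset.sum_congr rfl fun y hy => by rw [truncL2_apply, if_pos hy, sq]
  have h2 : ∑ y ∈ F, η y ^ 2 ≤ ‖η‖ ^ 2 := by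
    have := norm_sub_truncL2_sq η F
    nlinarith [sq_nonneg ‖η - toL2 (truncL2 η F)‖]
  exact (pow_le_pow_iff_left₀ (norm_nonneg _) (norm_nonneg _) two_ne_zero).1 (h1.trans h2)

/-- **Finitely supported vectors approximate `η` in `ℓ²`**: for `δ > 0` some truncation is `δ`-close (and not longer than `η`). [folklore] -/
theorem exists_truncL2_close (η : lp (fun _ : GPow k => ℝ) 2) {δ : ℝ} (hδ : 0 < δ) :
    ∃ F : Finset (GPow k), ‖η - toL2 (truncL2 η F)‖ < δ := by
  have h : Filter.Tendsto (fun s : Finset (GPow k) => ∑ y ∈ s, η y ^ 2) Filter.atTop (nhds (‖η‖ ^ 2)) := hasSum_sq_norm η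
  rw [Metric.tendsto_atTop] at h
  obtain ⟨F, hF⟩ := h (δ ^ 2) (by positivity)
  refine ⟨F, ?_⟩
  have hd := hF F le_rfl
  rw [Real.dist_eq] at hd
  have hsq : ‖η - toL2 (truncL2 η F)‖ ^ 2 < δ ^ 2 := by
    have := norm_sub_truncL2_sq η F
    have habs := (abs_lt.1 hd).1
    nlinarith
  exact lt_of_pow_lt_pow_left₀ 2 hδ.le hsq

/-- **(L4) THE EXTENSION LEMMA (critic P-37-c)**: for `K ∈ ℓ¹` and `k ≥ 1`, if `Σ_x |K x| ω_ξ(x) ≤ B κ₀(ξ)` for every finitely supported `ξ` with `κ₀(ξ) > 0`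
(the `⨆`-clause of DEFS-C's `laceNormE k K ≤ B`), then `Σ_x |K x| ω_η(x) ≤ B κ(η)` for EVERY `η ∈ ℓ²(𝔊^k)` — i.e. the operator inequality `±Ω ≼ B (1 − P)` that
β/γ use (P3-NILPOTENT (37.2)(iii)).  Proof: finitely supported case by hypothesis (or `κ₀ = 0 ⇒ ω ≡ 0`); truncations `η𝟙_F → η` in `ℓ²`; both sides are
locally Lipschitz in `η`. [cite: HeydenreichVanDerHofstad2017, Prop. 8.3, Lemma 8.11] -/
theorem tsum_abs_mul_omegaL2_le (hk : 1 ≤ k) {K : GPow k → ℝ} (hK : Summable fun x => |K x|) {B : ℝ}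
    (hB : ∀ ξ : GPow k →₀ ℝ, 0 < kappa0 k ξ → ∑' x, |K x| * omegaV ξ x ≤ B * kappa0 k ξ) (η : lp (fun _ : GPow k => ℝ) 2) :
    ∑' x, |K x| * omegaL2 η x ≤ B * kappaL2 k η := by
  -- the finitely supported case, in ℓ² language
  have hfin : ∀ ξ : GPow k →₀ ℝ, ∑' x, |K x| * omegaL2 (toL2 ξ) x ≤ B * kappaL2 k (toL2 ξ) := fun ξ => by
    simp_rw [omegaL2_toL2]
    rw [kappaL2_toL2 hk]
    exact tsum_abs_mul_omegaV_le hk hB ξ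
  -- approximation
  set L : ℝ := ∑' x, |K x| with hL
  have hL0 : 0 ≤ L := tsum_nonneg fun x => abs_nonneg _
  refine le_of_forall_pos_lt_add fun ε hε => ?_
  set D : ℝ := (L + |B|) * (4 * ‖η‖) + 1 with hD
  have hnn : 0 ≤ (L + |B|) * (4 * ‖η‖) := by positivity
  have hD0 : 0 < D := by rw [hD]; linarith
  obtain ⟨F, hF⟩ := exists_truncL2_close η (div_pos hε hD0)
  set ζ := toL2 (truncL2 η F) with hζ
  have hζn : ‖ζ‖ ≤ ‖η‖ := norm_toL2_truncL2_le η F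
  have hd0 : 0 ≤ ‖η - ζ‖ := norm_nonneg _
  have e1 := abs_tsum_abs_mul_omegaL2_sub_le η ζ hK
  have e2 := abs_kappaL2_sub_le hk η ζ
  have h3 := hfin (truncL2 η F)
  -- `2(‖η‖ + ‖ζ‖) ≤ 4‖η‖`
  have h4 : 2 * (‖η‖ + ‖ζ‖) * ‖η - ζ‖ ≤ 4 * ‖η‖ * ‖η - ζ‖ := by nlinarith [norm_nonneg η]
  have e1' : ∑' x, |K x| * omegaL2 η x ≤ ∑' x, |K x| * omegaL2 ζ x + L * (4 * ‖η‖ * ‖η - ζ‖) := by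
    have := (abs_le.1 e1).2
    nlinarith [mul_le_mul_of_nonneg_left h4 hL0]
  have e2' : B * kappaL2 k ζ ≤ B * kappaL2 k η + |B| * (4 * ‖η‖ * ‖η - ζ‖) := by
    have hk1 : |B * (kappaL2 k ζ - kappaL2 k η)| ≤ |B| * (4 * ‖η‖ * ‖η - ζ‖) := by
      rw [abs_mul]
      refine mul_le_mul_of_nonneg_left ?_ (abs_nonneg _)
      rw [abs_sub_comm]
      exact e2.trans h4
    have := (abs_le.1 hk1).2
    linarith
  have hsmall : (L + |B|) * (4 * ‖η‖ * ‖η - ζ‖) < ε := by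
    have hlt : ‖η - ζ‖ < ε / D := hF
    calc (L + |B|) * (4 * ‖η‖ * ‖η - ζ‖) = ((L + |B|) * (4 * ‖η‖)) * ‖η - ζ‖ := by ring
      _ ≤ ((L + |B|) * (4 * ‖η‖)) * (ε / D) := mul_le_mul_of_nonneg_left hlt.le (by positivity)
      _ < ε := by
          have hA : (L + |B|) * (4 * ‖η‖) < D := by rw [hD]; linarith
          calc (L + |B|) * (4 * ‖η‖) * (ε / D) = ε * ((L + |B|) * (4 * ‖η‖) / D) := by ring
            _ < ε * 1 := mul_lt_mul_of_pos_left ((div_lt_one hD0).2 hA) hε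
            _ = ε := mul_one ε
  linarith

/-! ## §5 `T ≽ 0` on all of `ℓ²` (design note p3 g43 #10305) -/

/-- `|⟪η, Tη⟫ − ⟪ζ, Tζ⟫| ≤ ‖T‖ (‖η‖ + ‖ζ‖) ‖η − ζ‖` for any bounded operator. [folklore] -/
theorem abs_inner_apply_sub_le (A : lp (fun _ : GPow k => ℝ) 2 →L[ℝ] lp (fun _ : GPow k => ℝ) 2) (η ζ : lp (fun _ : GPow k => ℝ) 2) :
    |⟪η, A η⟫_ℝ - ⟪ζ, A ζ⟫_ℝ| ≤ ‖A‖ * (‖η‖ + ‖ζ‖) * ‖η - ζ‖ := by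
  have h : ⟪η, A η⟫_ℝ - ⟪ζ, A ζ⟫_ℝ = ⟪η - ζ, A η⟫_ℝ + ⟪ζ, A (η - ζ)⟫_ℝ := by
    rw [inner_sub_left, map_sub, inner_sub_right]; ring
  rw [h]
  calc |⟪η - ζ, A η⟫_ℝ + ⟪ζ, A (η - ζ)⟫_ℝ| ≤ |⟪η - ζ, A η⟫_ℝ| + |⟪ζ, A (η - ζ)⟫_ℝ| := abs_add_le _ _
    _ ≤ ‖η - ζ‖ * ‖A η‖ + ‖ζ‖ * ‖A (η - ζ)‖ := add_le_add (abs_real_inner_le_norm _ _) (abs_real_inner_le_norm _ _)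
    _ ≤ ‖η - ζ‖ * (‖A‖ * ‖η‖) + ‖ζ‖ * (‖A‖ * ‖η - ζ‖) :=
        add_le_add (mul_le_mul_of_nonneg_left (A.le_opNorm η) (norm_nonneg _)) (mul_le_mul_of_nonneg_left (A.le_opNorm _) (norm_nonneg _))
    _ = ‖A‖ * (‖η‖ + ‖ζ‖) * ‖η - ζ‖ := by ring

/-- **`0 ≤ ⟪η, T η⟫` for every `η ∈ ℓ²(𝔊^k)`**, `p < p_c` (Aizenman–Newman positivity of the two-point matrix — E4.3b `conn_quadratic_nonneg` — on finitely supported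
vectors via (L1), extended to `ℓ²` by truncation). [cite: AizenmanNewman1984, §4 (positivity of the two-point function)] [cite: HeydenreichVanDerHofstad2017, §1.2] -/
theorem inner_twoPointOp_nonneg {p : unitInterval} (hp : (p : ℝ) < pcR k) (η : lp (fun _ : GPow k => ℝ) 2) : 0 ≤ ⟪η, twoPointOp k p η⟫_ℝ := by
  haveI : Countable (GPow k) := countable_of_connected_of_locallyFinite (gkCay k) (gkCay_connected k) 1
  have hfin : ∀ ξ : GPow k →₀ ℝ, 0 ≤ ⟪toL2 ξ, twoPointOp k p (toL2 ξ)⟫_ℝ := fun ξ => by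
    rw [inner_toL2_twoPointOp hp]
    exact conn_quadratic_nonneg (gkCay k) p ξ.support ξ
  refine le_of_forall_pos_lt_add fun ε hε => ?_
  set D : ℝ := ‖twoPointOp k p‖ * (2 * ‖η‖) + 1 with hD
  have hnn : 0 ≤ ‖twoPointOp k p‖ * (2 * ‖η‖) := by positivity
  have hD0 : 0 < D := by rw [hD]; linarith
  obtain ⟨F, hF⟩ := exists_truncL2_close η (div_pos hε hD0)
  set ζ := toL2 (truncL2 η F) with hζ
  have hζn : ‖ζ‖ ≤ ‖η‖ := norm_toL2_truncL2_le η F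
  have e := abs_inner_apply_sub_le (twoPointOp k p) η ζ
  have e' : |⟪η, twoPointOp k p η⟫_ℝ - ⟪ζ, twoPointOp k p ζ⟫_ℝ| ≤ ‖twoPointOp k p‖ * (2 * ‖η‖) * ‖η - ζ‖ :=
    e.trans (mul_le_mul_of_nonneg_right (mul_le_mul_of_nonneg_left (by linarith) (norm_nonneg _)) (norm_nonneg _))
  have hsmall : ‖twoPointOp k p‖ * (2 * ‖η‖) * ‖η - ζ‖ < ε := by
    calc ‖twoPointOp k p‖ * (2 * ‖η‖) * ‖η - ζ‖ ≤ ‖twoPointOp k p‖ * (2 * ‖η‖) * (ε / D) := mul_le_mul_of_nonneg_left hF.le hnn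
      _ < ε := by
          have hA : ‖twoPointOp k p‖ * (2 * ‖η‖) < D := by rw [hD]; linarith
          calc ‖twoPointOp k p‖ * (2 * ‖η‖) * (ε / D) = ε * (‖twoPointOp k p‖ * (2 * ‖η‖) / D) := by ring
            _ < ε * 1 := mul_lt_mul_of_pos_left ((div_lt_one hD0).2 hA) hε
            _ = ε := mul_one ε
  have h0 := hfin (truncL2 η F)
  have := (abs_le.1 e').1
  linarith

end NcHaraSlade

end Grigorchuk

end Summit.CriticalPhenomena.PercolationContinuityZ3.Theorems.Transplant

end
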